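import Mathlib
import Literature.NumberTheory.LFunctions.NumHelpers
import Summits.QuantumFields.BalabanUV.Beta.EriceRemainderEnclosureHistoryAutonomyComparisonAgeCompositionStaticChainAdjacentRatioEnvelopes
import Summits.QuantumFields.BalabanUV.Beta.EriceRemainderEnclosureHistoryAutonomyComparisonAgeCompositionStaticChainBandsMid
import Summits.QuantumFields.BalabanUV.Beta.EriceRemainderEnclosureHistoryAutonomyComparisonAgeCompositionStaticChainBandsD

/-!
# EriceRemainderEnclosureHistoryAutonomyComparisonAgeCompositionStaticChainBandsUpper — (E79p) THE OBSERVER STEP ABOVE EVERY NON-ADJACENT-OR-NOT PAIR WITH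
# `z∕y ≥ 3∕10`, `y ≥ 24`: the near-diagonal bands (E79o) for `4∕5 ≤ z∕y < 1`, and (E79n) for `3∕10 ≤ z∕y ≤ 4∕5` — so, with the adjacent family (E79g), the
# step inequality of the observer induction is a tree theorem for all scale ratios `q = y∕z ≤ 10∕3` above the threshold

Cell `pub-balaban`, β-function sub-cell, BINDER row D4 «RemainderConst leaves for Bałaban's split» (`HOME/BINDER-OWNERS.md`; owner lineage `b2b-balaban-beta-an4`;
this file by co-owner #2 lineage `b2b-balaban-beta-d4-p2`, generation 70), β-FLOW TEAM duty (1), FREEZE (0) honoured (def-free; imports (E78f) `…AdjacentRatioEnvelopes`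
(`thetabar_le_envelope`), (E79n) `…BandsMid` (`thetabar_le_band`, `band_step_lattice_mid`), (E79o) `…BandsD` (the four near-diagonal packages); nothing restated).

HONEST FRAMING (page 1, verbatim and binding).  *"Discharging BetaPertH makes Bałaban's UV stability UNCONDITIONAL — a real constructive-QFT result; it is
NOT the continuum limit and NOT the Clay problem."*  THIS FILE DISCHARGES NOTHING OF THE KIND.  Case analysis on a rational ratio plus tree theorems —
hypotheses of a census, not facts; the age profile of Bałaban's (1.22) limit functional is NOT PRINTED ([I] p. 298; GAPS G-t4-U2-1∕-2) and NOT asserted.  Row D4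
class UNCHANGED (critical-path width 0; instance 0∕1; D4 DISCHARGE NO DATE).  HONEST DEPENDENCY: continuum YM on T⁴ ⇐ BetaPertH ∧ nine spine estimates (0/9
proved); BetaPertH ⇐ (D1) ∧ (D4) ∧ CAP+tail; G-an2-4 gates asym, D1 and NE2/3/4.

THE POINT (census sense (α); route (N′); README `HOME/b2b-balaban-beta-d4-p2/g70/e79/README.md` §4).  §1 `band_step_lattice_near`: the near-diagonal range
`4∕5·y ≤ z ≤ y−1`, `y ≥ 24` — where the first-order margins of the whole induction are smallest (the binding configurations of README (E78) §4 live at `q → 1`) —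
from the four packages of (E79o) (their first-order upper corner is a cubic with NEGATIVE middle coefficients and minimum `0.05–0.45`, certified inside the
package by `Ψ(Ψ−c)²` and `(Ψ−d)²` hints).  §2 **`band_step_lattice_ge_three_tenths`**: with (E79n), THE OBSERVER STEP (◆) ABOVE EVERY PAIR OF SCALES WITH
`3∕10·y ≤ z ≤ y−1`, `y ≥ 24` (every ratio `1 < q ≤ 10∕3` above the threshold), every level-coupled configuration, every admissible load, natural defect hypothesis
`θ ≤ θ̄(y∕z)`.  STATE OF THE STEP INEQUALITY after (E79g) + this file: proved for all adjacent pairs (all `z`) and for all pairs with `q ≤ 10∕3`, `y ≥ 24`.  WHAT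
REMAINS (README §4–§5): `q > 10∕3` (narrow∕far bands with (E79h); margins large but envelopes scale with `√q`), the finitely many pairs with `y ≤ 23` and `q ≤ 10∕3`
(pair packages), then the assembly of the induction.  NOT CLAIMED: those; the static closure; anything about the flow; printed.

WHAT IS PROVED ([folklore]; 0 `def`, 0 sorry).  §1 `band_step_lattice_near`.  §2 **`band_step_lattice_ge_three_tenths`**.
-/
noncomputable section
open Finset

namespace Summit.QuantumFields.BalabanUV.Beta.EriceRemainderEnclosureHistoryAutonomyComparisonAgeCompositionStaticChainBandsUpper

open Summit.QuantumFields.BalabanUV.Beta.EriceRemainderEnclosureHistoryAutonomyComparisonAgeCompositionStaticChainAdjacentRatioEnvelopes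
open Summit.QuantumFields.BalabanUV.Beta.EriceRemainderEnclosureHistoryAutonomyComparisonAgeCompositionStaticChainBandTemplate
open Summit.QuantumFields.BalabanUV.Beta.EriceRemainderEnclosureHistoryAutonomyComparisonAgeCompositionStaticChainBandsMid
open Summit.QuantumFields.BalabanUV.Beta.EriceRemainderEnclosureHistoryAutonomyComparisonAgeCompositionStaticChainBandsD
open Literature.NumberTheory.LFunctions.VdC.Num (le_sqrt_of_sq_le)

/-! ## §1 The near-diagonal range `4∕5 ≤ z∕y`, `z + 1 ≤ y` -/

/-- **THE OBSERVER STEP (◆) ABOVE EVERY PAIR WITH `4∕5·y ≤ z ≤ y − 1`, `y ≥ 24`**, every level-coupled configuration, every admissible load (`κ = 31∕40`; defect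
hypothesis `θ ≤ θ̄(y∕z)`): the four near-diagonal packages (E79o) through (E79j) `band_pair_step_lattice`; defect constants by (E78f) `thetabar_le_envelope`
(`q ≥ 1`) or (E79n) `thetabar_le_band`. [folklore] -/
theorem band_step_lattice_near {n y z : ℕ} {k : ℕ → ℕ} {x a cy cz Sy Sz Ry Rz : ℕ → ℝ} {θ xy Ψyy Ψyz Ψzy Ψzz Ωz σ φ s : ℝ}
    (hy : 24 ≤ y) (hlo : (4/5:ℝ) * y ≤ z) (hzy : z + 1 ≤ y)
    (hn : 0 < n) (hk : ∀ l, l < n → y + 1 ≤ k l) (hx : ∀ l, l < n → 0 ≤ x l)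
    (hSy : ∀ l, l < n → Sy l = ∑ m ∈ range y, Real.sqrt ((k l : ℝ) / ((k l : ℝ) + m + 1)))
    (hSz : ∀ l, l < n → Sz l = ∑ m ∈ range z, Real.sqrt ((k l : ℝ) / ((k l : ℝ) + m + 1)))
    (hRy : ∀ l, l < n → Ry l = ∑ m ∈ range (k l), Real.sqrt ((y : ℝ) / ((y : ℝ) + m + 1)))
    (hRz : ∀ l, l < n → Rz l = ∑ m ∈ range (k l), Real.sqrt ((z : ℝ) / ((z : ℝ) + m + 1)))
    (ha0 : ∀ i, i < n → 0 < a i)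
    (ha : ∀ i, i < n → a i = 1 + ∑ l ∈ range n,
      (2 * x l * (∑ m ∈ range (k i), Real.sqrt ((k l : ℝ) / ((k l : ℝ) + m + 1))) / k l) * a l)
    (hcy : ∀ i, i < n → cy i = Ry i / (y : ℝ) + ∑ l ∈ range n,
      (2 * x l * (∑ m ∈ range (k i), Real.sqrt ((k l : ℝ) / ((k l : ℝ) + m + 1))) / k l) * cy l)
    (hcz : ∀ i, i < n → cz i = Rz i / (z : ℝ) + ∑ l ∈ range n,
      (2 * x l * (∑ m ∈ range (k i), Real.sqrt ((k l : ℝ) / ((k l : ℝ) + m + 1))) / k l) * cz l)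
    (hΨyy : Ψyy = ∑ l ∈ range n, (2 * x l * Sy l / k l) * cy l) (hΨyz : Ψyz = ∑ l ∈ range n, (2 * x l * Sz l / k l) * cy l)
    (hΨzy : Ψzy = ∑ l ∈ range n, (2 * x l * Sy l / k l) * cz l) (hΨzz : Ψzz = ∑ l ∈ range n, (2 * x l * Sz l / k l) * cz l)
    (hΩz : Ωz = ∑ l ∈ range n, x l * (z : ℝ) / k l)
    (hσ : σ = (∑ m ∈ range z, Real.sqrt ((y : ℝ) / ((y : ℝ) + m + 1))) / (y : ℝ))
    (hφ : φ = (∑ m ∈ range y, Real.sqrt ((z : ℝ) / ((z : ℝ) + m + 1))) / (z : ℝ))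
    (hs : s = (∑ m ∈ range y, Real.sqrt ((y : ℝ) / ((y : ℝ) + m + 1))) / (y : ℝ))
    (hθ : θ ≤ 1 - ((y : ℝ) / z) / ((y : ℝ) / z + 1) * Real.sqrt (((y : ℝ) / z) / ((y : ℝ) / z + 1)) * Real.exp (-(1 / (2 * ((y : ℝ) / z)))))
    (hxy : 0 ≤ xy) (hcap : 2 * xy * (s + Ψyy) < 1) :
    (1 + 2 * (31/40:ℝ) * Ψzz) * (1 - Ωz) - (1 - θ) * (xy * (1 + 2 * (31/40:ℝ) * Ψyy))
      ≤ (1 - xy * (1 + 2 * (31/40:ℝ) * Ψyy)) *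
        ((1 + 2 * (31/40:ℝ) * Ψzz + 4 * (31/40:ℝ) * xy * ((σ + Ψyz) * (φ + Ψzy)) / (1 - 2 * (s + Ψyy) * xy)) * ((1 - Ωz) - xy / ((y : ℝ) / (z : ℝ)))) := by
  have hy' : (24 : ℝ) ≤ y := by exact_mod_cast hy
  have hzy' : (z : ℝ) + 1 ≤ y := by exact_mod_cast hzy
  have hz1 : 1 ≤ z := by
    by_contra h
    have : (z : ℝ) ≤ 0 := by exact_mod_cast (show z ≤ 0 by omega)
    linarith
  have hzp : (0 : ℝ) < z := by exact_mod_cast (show 0 < z by omega)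
  have hhi : (z : ℝ) ≤ (1:ℝ) * y := by linarith
  have hq1 : (1 : ℝ) ≤ (y : ℝ) / z := by rw [le_div_iff₀ hzp]; linarith
  by_cases c0 : (z : ℝ) ≤ (17/20:ℝ) * y
  · have hzlo : 20 ≤ z := by
      by_contra h
      have : (z : ℝ) ≤ 19 := by exact_mod_cast (show z ≤ 19 by omega)
      linarith [show (4/5:ℝ) * (y : ℝ) ≤ z from hlo]
    exact band_pair_step_lattice (rl := (4/5:ℝ)) (rh := (17/20:ℝ)) (y0 := 24) (z0 := 20) (th := (1543/2000:ℝ)) (by norm_num) (by norm_num) (by omega) hzlo hz1 hzy hlo c0 facts_band_4_5_to_17_20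
      hn hk hx hSy hSz hRy hRz ha0 ha hcy hcz hΨyy hΨyz hΨzy hΨzz hΩz hσ hφ hs
      (hθ.trans (thetabar_le_band (ql := (20/17:ℝ)) (Lc := (367607/500000:ℝ)) (by norm_num) (by rw [le_div_iff₀ hzp]; linarith) (le_sqrt_of_sq_le (by norm_num) (by norm_num)) (by norm_num) (by norm_num))) hxy hcap
  by_cases c1 : (z : ℝ) ≤ (9/10:ℝ) * y
  · have hzlo : 21 ≤ z := by
      by_contra h
      have : (z : ℝ) ≤ 20 := by exact_mod_cast (show z ≤ 20 by omega)
      linarith [show (17/20:ℝ) * (y : ℝ) ≤ z from (not_le.mp c0).le]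
    exact band_pair_step_lattice (rl := (17/20:ℝ)) (rh := (9/10:ℝ)) (y0 := 24) (z0 := 21) (th := (491/625:ℝ)) (by norm_num) (by norm_num) (by omega) hzlo hz1 hzy (not_le.mp c0).le c1 facts_band_17_20_to_9_10
      hn hk hx hSy hSz hRy hRz ha0 ha hcy hcz hΨyy hΨyz hΨzy hΨzz hΩz hσ hφ hs
      (hθ.trans (thetabar_le_envelope hq1)) hxy hcap
  by_cases c2 : (z : ℝ) ≤ (19/20:ℝ) * y
  · have hzlo : 22 ≤ z := by
      by_contra h
      have : (z : ℝ) ≤ 21 := by exact_mod_cast (show z ≤ 21 by omega)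
      linarith [show (9/10:ℝ) * (y : ℝ) ≤ z from (not_le.mp c1).le]
    exact band_pair_step_lattice (rl := (9/10:ℝ)) (rh := (19/20:ℝ)) (y0 := 24) (z0 := 22) (th := (491/625:ℝ)) (by norm_num) (by norm_num) (by omega) hzlo hz1 hzy (not_le.mp c1).le c2 facts_band_9_10_to_19_20
      hn hk hx hSy hSz hRy hRz ha0 ha hcy hcz hΨyy hΨyz hΨzy hΨzz hΩz hσ hφ hs
      (hθ.trans (thetabar_le_envelope hq1)) hxy hcap
  have hzlo : 23 ≤ z := by
    by_contra h
    have : (z : ℝ) ≤ 22 := by exact_mod_cast (show z ≤ 22 by omega)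
    linarith [show (19/20:ℝ) * (y : ℝ) ≤ z from (not_le.mp c2).le]
  exact band_pair_step_lattice (rl := (19/20:ℝ)) (rh := (1:ℝ)) (y0 := 24) (z0 := 23) (th := (491/625:ℝ)) (by norm_num) (by norm_num) (by omega) hzlo hz1 hzy (not_le.mp c2).le hhi facts_band_19_20_to_1_1
    hn hk hx hSy hSz hRy hRz ha0 ha hcy hcz hΨyy hΨyz hΨzy hΨzz hΩz hσ hφ hs
    (hθ.trans (thetabar_le_envelope hq1)) hxy hcap

/-! ## §2 Every pair with `z∕y ≥ 3∕10` above the threshold -/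

/-- **THE OBSERVER STEP (◆) ABOVE EVERY PAIR OF SCALES WITH `3∕10·y ≤ z ≤ y − 1` AND `y ≥ 24`** — i.e. every scale ratio `1 < q = y∕z ≤ 10∕3` above the threshold —
for every level-coupled configuration of older ages and every admissible load, with the natural defect hypothesis `θ ≤ θ̄(y∕z)`: §1 and (E79n)
`band_step_lattice_mid`. [folklore] -/
theorem band_step_lattice_ge_three_tenths {n y z : ℕ} {k : ℕ → ℕ} {x a cy cz Sy Sz Ry Rz : ℕ → ℝ} {θ xy Ψyy Ψyz Ψzy Ψzz Ωz σ φ s : ℝ}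
    (hy : 24 ≤ y) (hlo : (3/10:ℝ) * y ≤ z) (hzy : z + 1 ≤ y)
    (hn : 0 < n) (hk : ∀ l, l < n → y + 1 ≤ k l) (hx : ∀ l, l < n → 0 ≤ x l)
    (hSy : ∀ l, l < n → Sy l = ∑ m ∈ range y, Real.sqrt ((k l : ℝ) / ((k l : ℝ) + m + 1)))
    (hSz : ∀ l, l < n → Sz l = ∑ m ∈ range z, Real.sqrt ((k l : ℝ) / ((k l : ℝ) + m + 1)))
    (hRy : ∀ l, l < n → Ry l = ∑ m ∈ range (k l), Real.sqrt ((y : ℝ) / ((y : ℝ) + m + 1)))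
    (hRz : ∀ l, l < n → Rz l = ∑ m ∈ range (k l), Real.sqrt ((z : ℝ) / ((z : ℝ) + m + 1)))
    (ha0 : ∀ i, i < n → 0 < a i)
    (ha : ∀ i, i < n → a i = 1 + ∑ l ∈ range n,
      (2 * x l * (∑ m ∈ range (k i), Real.sqrt ((k l : ℝ) / ((k l : ℝ) + m + 1))) / k l) * a l)
    (hcy : ∀ i, i < n → cy i = Ry i / (y : ℝ) + ∑ l ∈ range n,
      (2 * x l * (∑ m ∈ range (k i), Real.sqrt ((k l : ℝ) / ((k l : ℝ) + m + 1))) / k l) * cy l)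
    (hcz : ∀ i, i < n → cz i = Rz i / (z : ℝ) + ∑ l ∈ range n,
      (2 * x l * (∑ m ∈ range (k i), Real.sqrt ((k l : ℝ) / ((k l : ℝ) + m + 1))) / k l) * cz l)
    (hΨyy : Ψyy = ∑ l ∈ range n, (2 * x l * Sy l / k l) * cy l) (hΨyz : Ψyz = ∑ l ∈ range n, (2 * x l * Sz l / k l) * cy l)
    (hΨzy : Ψzy = ∑ l ∈ range n, (2 * x l * Sy l / k l) * cz l) (hΨzz : Ψzz = ∑ l ∈ range n, (2 * x l * Sz l / k l) * cz l)
    (hΩz : Ωz = ∑ l ∈ range n, x l * (z : ℝ) / k l)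
    (hσ : σ = (∑ m ∈ range z, Real.sqrt ((y : ℝ) / ((y : ℝ) + m + 1))) / (y : ℝ))
    (hφ : φ = (∑ m ∈ range y, Real.sqrt ((z : ℝ) / ((z : ℝ) + m + 1))) / (z : ℝ))
    (hs : s = (∑ m ∈ range y, Real.sqrt ((y : ℝ) / ((y : ℝ) + m + 1))) / (y : ℝ))
    (hθ : θ ≤ 1 - ((y : ℝ) / z) / ((y : ℝ) / z + 1) * Real.sqrt (((y : ℝ) / z) / ((y : ℝ) / z + 1)) * Real.exp (-(1 / (2 * ((y : ℝ) / z)))))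
    (hxy : 0 ≤ xy) (hcap : 2 * xy * (s + Ψyy) < 1) :
    (1 + 2 * (31/40:ℝ) * Ψzz) * (1 - Ωz) - (1 - θ) * (xy * (1 + 2 * (31/40:ℝ) * Ψyy))
      ≤ (1 - xy * (1 + 2 * (31/40:ℝ) * Ψyy)) *
        ((1 + 2 * (31/40:ℝ) * Ψzz + 4 * (31/40:ℝ) * xy * ((σ + Ψyz) * (φ + Ψzy)) / (1 - 2 * (s + Ψyy) * xy)) * ((1 - Ωz) - xy / ((y : ℝ) / (z : ℝ)))) := by
  by_cases c : (z : ℝ) ≤ (4/5:ℝ) * y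
  · exact band_step_lattice_mid hy hlo c hn hk hx hSy hSz hRy hRz ha0 ha hcy hcz hΨyy hΨyz hΨzy hΨzz hΩz hσ hφ hs hθ hxy hcap
  · exact band_step_lattice_near hy (not_le.mp c).le hzy hn hk hx hSy hSz hRy hRz ha0 ha hcy hcz hΨyy hΨyz hΨzy hΨzz hΩz hσ hφ hs hθ hxy hcap

end Summit.QuantumFields.BalabanUV.Beta.EriceRemainderEnclosureHistoryAutonomyComparisonAgeCompositionStaticChainBandsUpper

end
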